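import Summits.QuantumFields.GaugeBoot.TiltedBoxRedLinkCup
import HarnessLib

/-!
# The reduced half of the link mirror of the odd square tilted box: the cup integral (gauge-boot, L3 supplement: reduced-half in-plane mirrors, 6b/7)

HONEST FRAMING (cell `pub-gaugeboot`, page 1 of every file): the venture produces certified bounds
on lattice expectations at stated coupling, gauge group, dimension and torus size; NOT a mass gap,
NOT a continuum limit, NOT a string tension; NOT Yang–Mills-summit-bearing (barriers
`FixedCouplingUltralocality`, `PerturbativeInvisibility`). This module is bookkeeping for a small
structural NEGATIVE result (the REDUCED-half in-plane mirrors of the square tilted boxes are not of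
positive type in `d ≥ 3` at small coupling); it discharges nothing by itself.

## Content (odd box, `P ≥ 2`, `L ≥ 2`, compact metrisable `G`, continuous `ρ` with (R1))

The four gluing steps of `TiltedBoxRedLinkCup.lean` assembled by one-link resampling
(`DiagRPSUN.integral_pi_update_of_forall`):

* `not_hasLink_stand_of` — a standing plaquette `(x; {i, m})` does not contain a link `(y, m')`
  with `m' ∉ {i}` unless `m' = m` and `y ∈ {x, x + e_i}`; hence the twelve "the other standing
  plaquettes do not read the link being integrated" facts;
* ★★ **`integral_cup_eq`** — for a transverse plaquette `v = (z; q)` (`q₁, q₂ ≠ i`) and ANY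
  continuous factor `R` not reading the four links of `v`:
  `∫ W_v · W_{S₀} W_{S₁} W_{S₂} W_{S₃} · R ∏ dU = c₁⁴ ∫ W_{v + e_i} · R ∏ dU`
  (`S_a` the standing plaquette on the `a`-th link of `v`, `v + e_i` the ring one layer up).

Folklore strong-coupling gluing (M. Creutz, *Quarks, gluons and lattices* (1983) Ch. 8); elementary.
-/

noncomputable section

open QuotientAddGroup Finset Function MeasureTheory
open Literature.MathematicalPhysics.QuantumFieldTheory (haarProbability)
open Literature.MathematicalPhysics.QuantumFieldTheory.PlaquetteLowerBound (reTr)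
open Literature.RepresentationTheory.CompactGroups

namespace Summit.QuantumFields.GaugeBoot

namespace TiltedRP

namespace RedLink

variable {d : ℕ} {i j : Fin d} {L P N : ℕ} [NeZero L] [NeZero P]
  [DecidableEq (TiltedSite d i j (2 * P + 1) (2 * P + 1) L)]
variable {G : Type*} [Group G] [TopologicalSpace G] [IsTopologicalGroup G] [CompactSpace G]
  [MeasurableSpace G] [BorelSpace G] [SecondCountableTopology G]
variable (ρ : G →* Matrix (Fin N) (Fin N) ℂ) (q : DirPair d)

/-! ## The other standing plaquettes do not read the link being integrated -/

omit [NeZero L] [NeZero P] [DecidableEq (TiltedSite d i j (2 * P + 1) (2 * P + 1) L)] in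
/-- A standing plaquette `(x; {i, m})` contains the link `(y, m')` (`m' ≠ i`) only if `m' = m` and
`y ∈ {x, x + e_i}`. [folklore] -/
theorem not_hasLink_stand_of {x y : TiltedSite d i j (2 * P + 1) (2 * P + 1) L} {m m' : Fin d} (hm : m ≠ i) (hm' : m' ≠ i)
    (h : m' = m → y ≠ x ∧ y ≠ x + tiltedUnit d i j (2 * P + 1) (2 * P + 1) L i) :
    ¬ PairExp.HasLink (tiltedUnit d i j (2 * P + 1) (2 * P + 1) L) (stand q (x, m)) (y, m') := by
  rw [hasLink_stand_iff q hm]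
  rintro (h1 | h1 | h1 | h1)
  · exact hm' (Prod.mk.inj h1).2
  · obtain ⟨hy, hmm⟩ := Prod.mk.inj h1; exact (h hmm).2 hy
  · exact hm' (Prod.mk.inj h1).2
  · obtain ⟨hy, hmm⟩ := Prod.mk.inj h1; exact (h hmm).1 hy

section Cup

variable (z : TiltedSite d i j (2 * P + 1) (2 * P + 1) L) {c₁ : ℝ}
  (hR1 : ∀ x y : G, ∫ g, reTr ρ (x * g⁻¹) * reTr ρ (g * y) ∂haarProbability G = c₁ * reTr ρ (x * y))

omit [NeZero L] [NeZero P] [DecidableEq (TiltedSite d i j (2 * P + 1) (2 * P + 1) L)] [IsTopologicalGroup G] [CompactSpace G]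
  [MeasurableSpace G] [BorelSpace G] [SecondCountableTopology G] in
/-- `Re tr ρ ∘ f` is continuous for continuous `f`. [folklore] -/
theorem continuous_reTr_comp (hρ : Continuous ρ) {f : Config (TiltedSite d i j (2 * P + 1) (2 * P + 1) L) d G → G}
    (hf : Continuous f) : Continuous fun U => reTr ρ (f U) :=
  Complex.continuous_re.comp ((hρ.comp hf).matrix_trace)

omit [NeZero P] in
include hR1 in
/-- ★★ **THE CUP INTEGRAL.** For a transverse plaquette `v = (z; q)` (`q₁, q₂ ≠ i`) and any continuous
factor `R` that does not read the four links of `v`: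
`∫ W_v W_{S₀} W_{S₁} W_{S₂} W_{S₃} R ∏ dU = c₁⁴ ∫ W_{v+e_i} R ∏ dU`, the `S_a` being the standing
plaquettes on the links of `v` and `v + e_i` the ring plaquette one layer up. [folklore] -/
theorem integral_cup_eq (hP : 2 ≤ P) (hij : i ≠ j) (hL : 2 ≤ L) (hq1 : q.1.1 ≠ i) (hq2 : q.1.2 ≠ i) (hρ : Continuous ρ)
    {R : Config (TiltedSite d i j (2 * P + 1) (2 * P + 1) L) d G → ℝ} (hRc : Continuous R)
    (hR : ∀ (U : Config (TiltedSite d i j (2 * P + 1) (2 * P + 1) L) d G) (a : Fin 4) (s : G),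
      R (update U (PairExp.plink (tiltedUnit d i j (2 * P + 1) (2 * P + 1) L) (z, q) a) s) = R U) :
    ∫ U, plaqObs ρ (tiltedUnit d i j (2 * P + 1) (2 * P + 1) L) (z, q) U *
        (plaqObs ρ (tiltedUnit d i j (2 * P + 1) (2 * P + 1) L) (stand q (z, q.1.1)) U *
          plaqObs ρ (tiltedUnit d i j (2 * P + 1) (2 * P + 1) L) (stand q (z + tiltedUnit d i j (2 * P + 1) (2 * P + 1) L q.1.1, q.1.2)) U *
          plaqObs ρ (tiltedUnit d i j (2 * P + 1) (2 * P + 1) L) (stand q (z + tiltedUnit d i j (2 * P + 1) (2 * P + 1) L q.1.2, q.1.1)) U *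
          plaqObs ρ (tiltedUnit d i j (2 * P + 1) (2 * P + 1) L) (stand q (z, q.1.2)) U) * R U
        ∂(productHaar (TiltedSite d i j (2 * P + 1) (2 * P + 1) L) d G) =
      c₁ ^ 4 * ∫ U, plaqObs ρ (tiltedUnit d i j (2 * P + 1) (2 * P + 1) L) (z + tiltedUnit d i j (2 * P + 1) (2 * P + 1) L i, q) U * R U
        ∂(productHaar (TiltedSite d i j (2 * P + 1) (2 * P + 1) L) d G) := by
  have hq12 : q.1.1 ≠ q.1.2 := ne_of_lt q.2
  have he := tiltedUnit_ne_zero_all (d := d) hP hij hL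
  set e := tiltedUnit d i j (2 * P + 1) (2 * P + 1) L with he_def
  -- base inequalities
  have hb1 : ∀ m : Fin d, z ≠ z + e m := fun m h => he m (by simpa using h.symm)
  have hb2 : ∀ m : Fin d, m ≠ i → z ≠ z + e m + e i := fun m hm h => by
    have h1 := congrArg (axisCoord d L (2 * P + 1)) h
    rw [map_add (axisCoord d L (2 * P + 1)) (z + e m), axisCoord_add_of_ne z hm] at h1
    exact axisCoord_add_self_ne hP z (by rw [map_add]; exact h1.symm)
  have hb3 : ∀ m : Fin d, m ≠ i → z + e m ≠ z + e i := fun m hm h => by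
    have h1 := congrArg (axisCoord d L (2 * P + 1)) h
    rw [axisCoord_add_of_ne z hm] at h1
    exact axisCoord_add_self_ne hP z h1.symm
  -- the twelve non-reading facts (`S_b` does not contain `L_a`, `a ≠ b`)
  have k01 : ¬ PairExp.HasLink e (stand q (z + e q.1.1, q.1.2)) (z, q.1.1) :=
    not_hasLink_stand_of q hq2 hq1 fun h => absurd h hq12
  have k02 : ¬ PairExp.HasLink e (stand q (z + e q.1.2, q.1.1)) (z, q.1.1) :=
    not_hasLink_stand_of q hq1 hq1 fun _ => ⟨hb1 _, hb2 _ hq2⟩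
  have k03 : ¬ PairExp.HasLink e (stand q (z, q.1.2)) (z, q.1.1) :=
    not_hasLink_stand_of q hq2 hq1 fun h => absurd h hq12
  have k10 : ¬ PairExp.HasLink e (stand q (z, q.1.1)) (z + e q.1.1, q.1.2) :=
    not_hasLink_stand_of q hq1 hq2 fun h => absurd h.symm hq12
  have k12 : ¬ PairExp.HasLink e (stand q (z + e q.1.2, q.1.1)) (z + e q.1.1, q.1.2) :=
    not_hasLink_stand_of q hq1 hq2 fun h => absurd h.symm hq12
  have k13 : ¬ PairExp.HasLink e (stand q (z, q.1.2)) (z + e q.1.1, q.1.2) :=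
    not_hasLink_stand_of q hq2 hq2 fun _ => ⟨(hb1 _).symm, hb3 _ hq1⟩
  have k20 : ¬ PairExp.HasLink e (stand q (z, q.1.1)) (z + e q.1.2, q.1.1) :=
    not_hasLink_stand_of q hq1 hq1 fun _ => ⟨(hb1 _).symm, hb3 _ hq2⟩
  have k21 : ¬ PairExp.HasLink e (stand q (z + e q.1.1, q.1.2)) (z + e q.1.2, q.1.1) :=
    not_hasLink_stand_of q hq2 hq1 fun h => absurd h hq12
  have k23 : ¬ PairExp.HasLink e (stand q (z, q.1.2)) (z + e q.1.2, q.1.1) :=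
    not_hasLink_stand_of q hq2 hq1 fun h => absurd h hq12
  have k30 : ¬ PairExp.HasLink e (stand q (z, q.1.1)) (z, q.1.2) :=
    not_hasLink_stand_of q hq1 hq2 fun h => absurd h.symm hq12
  have k31 : ¬ PairExp.HasLink e (stand q (z + e q.1.1, q.1.2)) (z, q.1.2) :=
    not_hasLink_stand_of q hq2 hq2 fun _ => ⟨hb1 _, hb2 _ hq1⟩
  have k32 : ¬ PairExp.HasLink e (stand q (z + e q.1.2, q.1.1)) (z, q.1.2) :=
    not_hasLink_stand_of q hq1 hq2 fun h => absurd h.symm hq12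
  -- the ring does not read the links of `v` (it lies one layer up)
  have hlay : (axisCoord d L (2 * P + 1) (z + e i)) ≠ axisCoord d L (2 * P + 1) z := axisCoord_add_self_ne hP z
  have kr : ∀ a : Fin 4, ¬ PairExp.HasLink e (z + e i, q) (PairExp.plink e ((z, q) : Plaq _ d) a) := fun a =>
    not_hasLink_transverse_of_axisCoord_ne q hq1 hq2 hlay.symm ⟨a, rfl⟩
  -- continuity of the plaquette observables and of the glued words
  have hcW : ∀ p : Plaq (TiltedSite d i j (2 * P + 1) (2 * P + 1) L) d, Continuous (plaqObs (G := G) ρ e p) :=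
    fun p => continuous_plaqObs ρ hρ e p
  have hcA : Continuous (wA (G := G) ρ q z) := by unfold wA; exact continuous_reTr_comp ρ hρ (by fun_prop)
  have hcB : Continuous (wB (G := G) ρ q z) := by unfold wB; exact continuous_reTr_comp ρ hρ (by fun_prop)
  have hcC : Continuous (wC (G := G) ρ q z) := by unfold wC; exact continuous_reTr_comp ρ hρ (by fun_prop)
  haveI := isProbabilityMeasure_productHaar (A := TiltedSite d i j (2 * P + 1) (2 * P + 1) L) (d := d) (G := G)
  unfold productHaar
  -- Step A: the link `(z, q₁)`
  refine Eq.trans (DiagRPSUN.integral_pi_update_of_forall (haarProbability G) ((z, q.1.1) : Link _ d)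
    (H := fun U => c₁ * (wA ρ q z U * (plaqObs ρ e (stand q (z + e q.1.1, q.1.2)) U *
      plaqObs ρ e (stand q (z + e q.1.2, q.1.1)) U * plaqObs ρ e (stand q (z, q.1.2)) U) * R U))
    (TwistedSlab.integrable_config_of_continuous ((((hcW _).mul ((((hcW _).mul (hcW _)).mul (hcW _)).mul
      (hcW _))).mul hRc))) fun U => ?_) ?_
  · have hRU : ∀ s, R (update U (z, q.1.1) s) = R U := fun s => hR U 0 s
    simp_rw [PairExp.plaqObs_update_of_not_hasLink e ρ _ k01, PairExp.plaqObs_update_of_not_hasLink e ρ _ k02,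
      PairExp.plaqObs_update_of_not_hasLink e ρ _ k03, hRU]
    simp_rw [show ∀ s, plaqObs ρ e (z, q) (update U (z, q.1.1) s) *
        (plaqObs ρ e (stand q (z, q.1.1)) (update U (z, q.1.1) s) * plaqObs ρ e (stand q (z + e q.1.1, q.1.2)) U *
          plaqObs ρ e (stand q (z + e q.1.2, q.1.1)) U * plaqObs ρ e (stand q (z, q.1.2)) U) * R U =
        plaqObs ρ e (z, q) (update U (z, q.1.1) s) * plaqObs ρ e (stand q (z, q.1.1)) (update U (z, q.1.1) s) *
          (plaqObs ρ e (stand q (z + e q.1.1, q.1.2)) U * plaqObs ρ e (stand q (z + e q.1.2, q.1.1)) U *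
            plaqObs ρ e (stand q (z, q.1.2)) U * R U) from fun s => by ring]
    rw [integral_mul_const, glueA ρ q z hR1 hP hij hL hq1 hρ]
    ring
  -- Step B: the link `(z + e_{q₁}, q₂)`
  refine Eq.trans (DiagRPSUN.integral_pi_update_of_forall (haarProbability G) ((z + e q.1.1, q.1.2) : Link _ d)
    (H := fun U => c₁ * (c₁ * (wB ρ q z U * (plaqObs ρ e (stand q (z + e q.1.2, q.1.1)) U *
      plaqObs ρ e (stand q (z, q.1.2)) U) * R U)))
    ((TwistedSlab.integrable_config_of_continuous ((hcA.mul (((hcW _).mul (hcW _)).mul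
      (hcW _))).mul hRc)).const_mul c₁) fun U => ?_) ?_
  · have hRU : ∀ s, R (update U (z + e q.1.1, q.1.2) s) = R U := fun s => hR U 1 s
    simp_rw [PairExp.plaqObs_update_of_not_hasLink e ρ _ k12, PairExp.plaqObs_update_of_not_hasLink e ρ _ k13, hRU]
    simp_rw [show ∀ s, c₁ * (wA ρ q z (update U (z + e q.1.1, q.1.2) s) *
        (plaqObs ρ e (stand q (z + e q.1.1, q.1.2)) (update U (z + e q.1.1, q.1.2) s) *
          plaqObs ρ e (stand q (z + e q.1.2, q.1.1)) U * plaqObs ρ e (stand q (z, q.1.2)) U) * R U) =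
        wA ρ q z (update U (z + e q.1.1, q.1.2) s) *
          plaqObs ρ e (stand q (z + e q.1.1, q.1.2)) (update U (z + e q.1.1, q.1.2) s) *
          (c₁ * (plaqObs ρ e (stand q (z + e q.1.2, q.1.1)) U * plaqObs ρ e (stand q (z, q.1.2)) U * R U))
        from fun s => by ring]
    rw [integral_mul_const, glueB ρ q z hR1 hP hij hL hq2 hρ]
    ring
  -- Step C: the link `(z + e_{q₂}, q₁)`
  refine Eq.trans (DiagRPSUN.integral_pi_update_of_forall (haarProbability G) ((z + e q.1.2, q.1.1) : Link _ d)
    (H := fun U => c₁ * (c₁ * (c₁ * (wC ρ q z U * plaqObs ρ e (stand q (z, q.1.2)) U * R U))))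
    (((TwistedSlab.integrable_config_of_continuous ((hcB.mul ((hcW _).mul (hcW _))).mul
      hRc)).const_mul c₁).const_mul c₁) fun U => ?_) ?_
  · have hRU : ∀ s, R (update U (z + e q.1.2, q.1.1) s) = R U := fun s => hR U 2 s
    simp_rw [PairExp.plaqObs_update_of_not_hasLink e ρ _ k23, hRU]
    simp_rw [show ∀ s, c₁ * (c₁ * (wB ρ q z (update U (z + e q.1.2, q.1.1) s) *
        (plaqObs ρ e (stand q (z + e q.1.2, q.1.1)) (update U (z + e q.1.2, q.1.1) s) *
          plaqObs ρ e (stand q (z, q.1.2)) U) * R U)) =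
        wB ρ q z (update U (z + e q.1.2, q.1.1) s) *
          plaqObs ρ e (stand q (z + e q.1.2, q.1.1)) (update U (z + e q.1.2, q.1.1) s) *
          (c₁ * (c₁ * (plaqObs ρ e (stand q (z, q.1.2)) U * R U))) from fun s => by ring]
    rw [integral_mul_const, glueC ρ q z hR1 hP hij hL hq1 hq2 hρ]
    ring
  -- Step D: the link `(z, q₂)`
  refine Eq.trans (DiagRPSUN.integral_pi_update_of_forall (haarProbability G) ((z, q.1.2) : Link _ d)
    (H := fun U => c₁ * (c₁ * (c₁ * (c₁ * (plaqObs ρ e (z + e i, q) U * R U)))))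
    ((((TwistedSlab.integrable_config_of_continuous ((hcC.mul (hcW _)).mul hRc)).const_mul
      c₁).const_mul c₁).const_mul c₁) fun U => ?_) ?_
  · have hRU : ∀ s, R (update U (z, q.1.2) s) = R U := fun s => hR U 3 s
    simp_rw [hRU]
    simp_rw [show ∀ s, c₁ * (c₁ * (c₁ * (wC ρ q z (update U (z, q.1.2) s) *
        plaqObs ρ e (stand q (z, q.1.2)) (update U (z, q.1.2) s) * R U))) =
        wC ρ q z (update U (z, q.1.2) s) * plaqObs ρ e (stand q (z, q.1.2)) (update U (z, q.1.2) s) *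
          (c₁ * (c₁ * (c₁ * R U))) from fun s => by ring]
    rw [integral_mul_const, glueD ρ q z hR1 hP hij hL hq1 hq2 hρ]
    ring
  rw [← integral_const_mul]
  refine integral_congr_ae (ae_of_all _ fun U => ?_)
  ring

end Cup

end RedLink

end TiltedRP

end Summit.QuantumFields.GaugeBoot

end
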